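import Summits.BirchSwinnertonDyer.Rank1Residual.Additive.GordRamifiedOrdinaryLine
import Summits.BirchSwinnertonDyer.Rank1Residual.AdditivePotMult.RamifiedOrdinaryLinePotMult
import Summits.BirchSwinnertonDyer.Rank1Residual.Additive.RamifiedOrdinaryLineUniqueModelFree
import HarnessLib

/-!
# The inertia EXPONENT of the ramified ordinary line is `2` on every defect-2 row — (M) and
# (G-ord, `e = 2`) — for EVERY ramified ordinary line (model-free via uniqueness)
# (cell `b2b-bsdres`, team n1011, seat p07 (gen 7); row T-ROL-EXP FILE B0; the `n = 2` supply for
# cc-typer-2's model-free line matching S3)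

HONEST FRAMING (cell `b2b-bsdres`, run/shared/lean/b2b/bsd-rank1-residual/, verbatim in every
file): the goal of the cell is to DELETE the COMBINATION-SHAPED residual classes of the
Birch–Swinnerton-Dyer formula for ALL analytic-rank `≤ 1` elliptic curves over `ℚ` — "full BSD
formula for every rank `≤ 1` curve in class `C`" assembled STRICTLY from published theorems — so
that the rank-`≤ 1` remainder becomes exactly the CONSTRUCTION-SHAPED classes, which are TYPED
(missing-input `Prop`s), NOT attempted. This is not "finishing BSD". Team n1011 (RESIDUAL-MAP §I
N10/N11 on the defect-2 rows (M) = X4(M)/X3♯(M) and (G-ord, `e = 2`) = X4♯/X3♯(G-ord) ∩ `I₀*`):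
research route; labels and marks UNCHANGED; nothing booked. TOOL theorems only: NO definition, NO new
named fact. §3 is CONDITIONAL on the tree's EXISTING named facts A40/A41 (Silverman *ATAEC* V.3.1 /
V.5.3 / V.5.4: hypotheses `hT40`, `hT41`) exactly as the consumed (M) line file; §1–§2 and §4 are
unconditional.

## What and why

cc-typer-1's predicate `EmertonPollackWeston2006.IsRamifiedOrdinaryLine W p L` (EPW §3.1 `A'_{f̃,a}`;
Coates' canonical subgroup) records that inertia acts on `E[p^∞]/C` through SOME finite exponent
(`∃ n ≥ 1, ∀ σ ∈ I_v, σⁿ m − m ∈ C`). cc-typer-2's model-free LINE MATCHING (S3,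
`RamifiedOrdinaryLineMatchingModelFree`) needs the exponent EXPLICITLY (`¬ (p−1) ∣ lcm(n, n₁)`). On the
defect-2 rows the exponent is `2` — the quotient is `D ⊗ χ_{p*}` with `D` unramified — and the tree's
constructions prove exactly this inside their clause-4 step without exporting it: p10's
`RamifiedOrdinaryLineTransport.transport_sq_smul_sub_mem` (Greenberg's `C_v` of the good-ordinary
`p*`-twist model, transported) and p07's quotient SHAPE of the Tate line transported
(`RamifiedOrdinaryLinePotMult.exists_isRamifiedOrdinaryLine_shape_of_mult_twist` (2)). This file
exports `n = 2` for THOSE lines (§1–§3) and moves it to EVERY ramified ordinary line by cc-typer-2's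
model-free uniqueness `IsRamifiedOrdinaryLine.eq_of_isRamifiedOrdinaryLine` (§4):
`sq_smul_sub_mem_of_typeGOrd_of_semistabilityIndex_eq_two`, `PotMult.sq_smul_sub_mem`, and the class
forms `ClassX4Gord/ClassX3Gord/ClassX4M/ClassX3M.sq_smul_sub_mem_of_isRamifiedOrdinaryLine`.

References: M. Emerton, R. Pollack, T. Weston, Invent. Math. 163 (2006) §3.1 (arXiv:math/0404484
p. 17) [EmertonPollackWeston2006]; R. Greenberg, LNM 1716 (1999) §2 pp. 62–63, 69 [GreenbergLNM1716];
R. Greenberg, V. Vatsal, Invent. Math. 142 (2000) §2 pp. 14–15, 26 [GreenbergVatsal2000];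
J. H. Silverman, *AEC* X.5 Cor. 5.4 [SilvermanAEC2009]; *ATAEC* V.3.1, V.5.3, V.5.4 [SilvermanATAEC1994];
cells/n1011/skel/T-ROL-EXP.md (67779f27699eb635); HOME/INBOX.md 2026-08-21T15:47Z (cc-typer-2 S3).
-/

set_option autoImplicit false

noncomputable section

open scoped Classical NumberField

open NumberField IsDedekindDomain Field WeierstrassCurve
  Literature.NumberTheory.GaloisRepresentations
  Literature.NumberTheory.EllipticCurves
  Literature.NumberTheory.EllipticCurves.Rank1Residual
  Literature.NumberTheory.EllipticCurves.GreenbergSelmer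
  Literature.NumberTheory.EllipticCurves.EmertonPollackWeston2006
  IsDedekindDomain.HeightOneSpectrum
  Summit.BirchSwinnertonDyer.Rank1Residual.X2
  Summit.BirchSwinnertonDyer.Rank1Residual.X2.GreenbergVatsalReductionDatum
open WeierstrassCurve (minimalDiscriminantInt)

namespace Summit.BirchSwinnertonDyer.Rank1Residual.Additive

namespace RamifiedOrdinaryLineExponentTwo

/-! ### §1 The transported line WITH its exponent (p10's transport, exponent exported) -/

section Transport

variable (p : ℕ) [hp : Fact p.Prime] {v : HeightOneSpectrum (𝓞 ℚ)} {W₁ W₂ : WeierstrassCurve ℚ}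

/-- **The transported line with its exponent `2`.** p10's `exists_isRamifiedOrdinaryLine_of_signEquivariant`
(a `D_v`-stable divisible proper non-zero `C ⊂ E₁[p^∞]` with inertia TRIVIAL on `E₁[p^∞]/C`,
transported along a sign-equivariant `e : E₁[p^∞] ≃+ E₂[p^∞]` anti-equivariant at one inertia
element, is a ramified ordinary line of `E₂`) TOGETHER WITH the clause it proves on the way
(`transport_sq_smul_sub_mem`): every local inertia element acts on `E₂[p^∞]/e(C)` through exponent
`2` (the quotient is `(E₁[p^∞]/C) ⊗ χ`, `χ² = 1`; EPW §3.1: `A''_{f̃,a}` with `a = (p−1)/2`).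
[cite: EmertonPollackWeston2006, §3.1 (eq:ordes) (arXiv:math/0404484 p. 17)]
[cite: GreenbergLNM1716, §2 pp. 62–63 and p. 69] -/
theorem exists_isRamifiedOrdinaryLine_and_sq_of_signEquivariant (hp2 : p ≠ 2)
    (L : LocalDatum ℚ ↥(W₁.geomPrimaryTorsion p) v)
    (e : ↥(W₁.geomPrimaryTorsion p) ≃+ ↥(W₂.geomPrimaryTorsion p))
    (he : ∀ σ : absoluteGaloisGroup ℚ, (∀ m, e (σ • m) = σ • e m) ∨ (∀ m, e (σ • m) = -(σ • e m)))
    (hdiv : ∀ m ∈ L.plus, ∃ m' ∈ L.plus, p • m' = m) (htop : L.plus ≠ ⊤) (hbot : L.plus ≠ ⊥)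
    (htriv : ∀ x ∈ inertia v, ∀ m : ↥(W₁.geomPrimaryTorsion p), x • m - m ∈ L.plus)
    (hram : ∃ σ₀ ∈ absInertia (v.adicCompletion ℚ), ∀ m : ↥(W₁.geomPrimaryTorsion p),
      e (absGaloisRestrict ℚ (v.adicCompletion ℚ) σ₀ • m) =
        -(absGaloisRestrict ℚ (v.adicCompletion ℚ) σ₀ • e m)) :
    ∃ L₂ : LocalDatum ℚ ↥(W₂.geomPrimaryTorsion p) v, IsRamifiedOrdinaryLine W₂ p L₂ ∧
      ∀ σ ∈ absInertia (v.adicCompletion ℚ), ∀ m : ↥(W₂.geomPrimaryTorsion p),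
        (absGaloisRestrict ℚ (v.adicCompletion ℚ) σ) ^ 2 • m - m ∈ L₂.plus := by
  obtain ⟨L₂, hL₂⟩ := exists_localDatum_transport L e he
  exact ⟨L₂, isRamifiedOrdinaryLine_of_transport hp2 L e he L₂ hL₂ hdiv htop hbot htriv hram,
    transport_sq_smul_sub_mem L e he L₂ hL₂ htriv⟩

end Transport

/-! ### §2 (G-ord, `e = 2`): Greenberg's `C_v` of the good-ordinary `p*`-twist model, transported, has
exponent `2` -/

section Gord

variable (p : ℕ) [hp : Fact p.Prime] {v : HeightOneSpectrum (𝓞 ℚ)}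

/-- **Exponent `2` on a `ℚ`-model of a ramified quadratic twist of a good-ordinary curve.** p10's
`exists_isRamifiedOrdinaryLine_of_goodOrd_model_twist` with the exponent exported: `V/ℚ` globally
minimal, `p` odd, `p ∤ Δ_V`, `p ∤ a_p(V)`, `v ∋ p`, `ord_v d = 1`, `W = C • V^{(d)}`; then SOME ramified
ordinary line of `W` at `v` has every inertia element acting on its quotient through exponent `2`
(Greenberg LNM 1716 p. 63: inertia is trivial on `V[p^∞]/C_v(V)`; twisted by the ramified `χ_d`).
[cite: EmertonPollackWeston2006, §3.1 (eq:ordes) (arXiv:math/0404484 p. 17)]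
[cite: GreenbergLNM1716, §2 pp. 62–63 and p. 69] [cite: SilvermanAEC2009, X.5 Cor. 5.4] -/
theorem exists_isRamifiedOrdinaryLine_and_sq_of_goodOrd_model_twist (hp2 : p ≠ 2)
    (V : WeierstrassCurve ℚ) [V.IsElliptic] [V.IsGloballyMinimal]
    (hpv : ((p : ℕ) : 𝓞 ℚ) ∈ v.asIdeal) (hΔ : ¬ (p : ℤ) ∣ minimalDiscriminantInt V)
    (hord : ¬ (p : ℤ) ∣ V.frobeniusTrace p)
    {d : ℤ} (hd : v.intValuation (d : 𝓞 ℚ) = WithZero.exp (-1 : ℤ))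
    {W : WeierstrassCurve ℚ} (hCW : ∃ C : VariableChange ℚ, C • V.quadraticTwist (d : ℚ) = W) :
    ∃ L : LocalDatum ℚ ↥(W.geomPrimaryTorsion p) v, IsRamifiedOrdinaryLine W p L ∧
      ∀ σ ∈ absInertia (v.adicCompletion ℚ), ∀ m : ↥(W.geomPrimaryTorsion p),
        (absGaloisRestrict ℚ (v.adicCompletion ℚ) σ) ^ 2 • m - m ∈ L.plus := by
  have hd0 : (d : ℚ) ≠ 0 := by
    intro h
    have hdz : (d : 𝓞 ℚ) = 0 := by exact_mod_cast (Int.cast_eq_zero.1 h)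
    rw [hdz, map_zero] at hd
    exact WithZero.zero_ne_coe hd
  haveI : NeZero (2 : ℚ) := ⟨two_ne_zero⟩
  obtain ⟨e, he, -, heneg⟩ := exists_addEquiv_geomPrimaryTorsion_of_model_twist_sign p V hd0 hCW
  obtain ⟨σ₀, hσ₀, hσneg⟩ := exists_mem_absInertia_smul_geomSqrt_eq_neg p hp2 hpv hd
  exact exists_isRamifiedOrdinaryLine_and_sq_of_signEquivariant p hp2 (reductionDatum V p hpv hΔ) e he
    (reductionDatum_divisible V p hpv hΔ hord) (reductionDatum_plus_ne_top V p hpv hΔ hord)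
    (reductionDatum_plus_ne_bot V p hpv hΔ hord) (reductionDatum_htriv V p hpv hΔ)
    ⟨σ₀, hσ₀, heneg _ hσneg⟩

/-- **The `p*`-twist model form**: `p` odd, `V` globally minimal good ordinary at `p`
(`GoodOrd V p`), `W = C • V^{(p*)}` ⟹ some ramified ordinary line of `W` at `v ∋ p` has inertia
exponent `2` on its quotient. [cite: EmertonPollackWeston2006, §3.1 (eq:ordes) (arXiv:math/0404484 p. 17)]
[cite: GreenbergLNM1716, §2 pp. 62–63 and p. 69] -/
theorem exists_isRamifiedOrdinaryLine_and_sq_of_goodOrd_pStar_twist (hp2 : p ≠ 2)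
    (V : WeierstrassCurve ℚ) [V.IsElliptic] [V.IsGloballyMinimal]
    {W : WeierstrassCurve ℚ}
    (hCW : ∃ C : VariableChange ℚ, C • V.quadraticTwist ((-1 : ℚ) ^ (p / 2) * p) = W)
    (hV : GoodOrd V p) (hpv : ((p : ℕ) : 𝓞 ℚ) ∈ v.asIdeal) :
    ∃ L : LocalDatum ℚ ↥(W.geomPrimaryTorsion p) v, IsRamifiedOrdinaryLine W p L ∧
      ∀ σ ∈ absInertia (v.adicCompletion ℚ), ∀ m : ↥(W.geomPrimaryTorsion p),
        (absGaloisRestrict ℚ (v.adicCompletion ℚ) σ) ^ 2 • m - m ∈ L.plus := by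
  have hCW' : ∃ C : VariableChange ℚ,
      C • V.quadraticTwist ((((-1 : ℤ) ^ (p / 2) * p : ℤ)) : ℚ) = W := by
    push_cast
    exact hCW
  exact exists_isRamifiedOrdinaryLine_and_sq_of_goodOrd_model_twist p hp2 V hpv
    (V.not_dvd_minimalDiscriminantInt_of_hasGoodReductionAtPrime' p hV.1) hV.2
    (intValuation_pStar p hpv) hCW'

variable {p} {W : WeierstrassCurve ℚ} [W.IsElliptic] [W.IsGloballyMinimal]

/-- **(G-ord, `e = 2`), `p` odd: SOME ramified ordinary line of `E` at `v ∋ p` has inertia exponent `2`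
on its quotient** — class-free binders `TypeGOrd W p ∧ Addv W p ∧ e_E(p) = 2` (the good-ordinary
`p*`-twist model `TypeGOrd.exists_goodOrd_pStar_twist_model`). [cite: EmertonPollackWeston2006, §3.1 (eq:ordes) (arXiv:math/0404484 p. 17)]
[cite: GreenbergLNM1716, §2 pp. 62–63 and p. 69] -/
theorem exists_isRamifiedOrdinaryLine_and_sq_of_typeGOrd (hp2 : p ≠ 2) (hG : TypeGOrd W p)
    (hadd : Addv W p) (he : semistabilityIndex W p = 2) (hpv : ((p : ℕ) : 𝓞 ℚ) ∈ v.asIdeal) :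
    ∃ L : LocalDatum ℚ ↥(W.geomPrimaryTorsion p) v, IsRamifiedOrdinaryLine W p L ∧
      ∀ σ ∈ absInertia (v.adicCompletion ℚ), ∀ m : ↥(W.geomPrimaryTorsion p),
        (absGaloisRestrict ℚ (v.adicCompletion ℚ) σ) ^ 2 • m - m ∈ L.plus := by
  obtain ⟨V, _, _, C, hord, hC⟩ := TypeGOrd.exists_goodOrd_pStar_twist_model W p hp2 hG hadd he
  exact exists_isRamifiedOrdinaryLine_and_sq_of_goodOrd_pStar_twist p hp2 V ⟨C, hC⟩ hord hpv

end Gord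

/-! ### §3 Exponent `2` from a quotient SHAPE `res σ • x ∓ x ∈ C` (the (M) rows, mod A40/A41) -/

section Shape

variable {p : ℕ} {v : HeightOneSpectrum (𝓞 ℚ)} {W : WeierstrassCurve ℚ}

/-- **A quotient of shape `D ⊗ χ`, `χ² = 1`, has exponent `2`.** If every local inertia element `σ`
acts on `E[p^∞]/C` as `+1` (`res σ • x − x ∈ C` for all `x`) or as `−1` (`res σ • x + x ∈ C` for all
`x`), then `(res σ)² • x − x ∈ C`: `σ²x − x = σ(σx ∓ x) ± (σx ∓ x)` and `C` is `D_v`-stable.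
[cite: EmertonPollackWeston2006, §3.1 (eq:ordes) (arXiv:math/0404484 p. 17)] -/
theorem sq_smul_sub_mem_of_quotientShape (L : LocalDatum ℚ ↥(W.geomPrimaryTorsion p) v)
    (hshape : ∀ σ ∈ absInertia (v.adicCompletion ℚ),
      (∀ x : ↥(W.geomPrimaryTorsion p), absGaloisRestrict ℚ (v.adicCompletion ℚ) σ • x - x ∈ L.plus) ∨
      (∀ x : ↥(W.geomPrimaryTorsion p), absGaloisRestrict ℚ (v.adicCompletion ℚ) σ • x + x ∈ L.plus)) :
    ∀ σ ∈ absInertia (v.adicCompletion ℚ), ∀ m : ↥(W.geomPrimaryTorsion p),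
      (absGaloisRestrict ℚ (v.adicCompletion ℚ) σ) ^ 2 • m - m ∈ L.plus := by
  intro σ hσ m
  set g := absGaloisRestrict ℚ (v.adicCompletion ℚ) σ with hg
  rw [pow_two, mul_smul]
  rcases hshape σ hσ with h | h
  · have hsplit : g • g • m - m = g • (g • m - m) + (g • m - m) := by
      rw [smul_sub]; abel
    rw [hsplit]
    exact add_mem (L.smul_mem σ (h m)) (h m)
  · have hsplit : g • g • m - m = g • (g • m + m) - (g • m + m) := by
      rw [smul_add]; abel
    rw [hsplit]
    exact sub_mem (L.smul_mem σ (h m)) (h m)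

end Shape

end RamifiedOrdinaryLineExponentTwo

end Summit.BirchSwinnertonDyer.Rank1Residual.Additive

/-! ### §3 (continued) The (M) rows: the transported Tate line has exponent `2` (mod A40/A41) -/

namespace Summit.BirchSwinnertonDyer.Rank1Residual.AdditivePotMult

open Summit.BirchSwinnertonDyer.Rank1Residual.Additive
  Summit.BirchSwinnertonDyer.Rank1Residual.Additive.RamifiedOrdinaryLineExponentTwo
  RamifiedOrdinaryLinePotMult

variable {W : WeierstrassCurve ℚ} [W.IsElliptic] {p : ℕ} [hp : Fact p.Prime]
  {v : HeightOneSpectrum (𝓞 ℚ)}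

/-- **pot-mult(p), odd `p`: SOME ramified ordinary line of `E` at `v ∋ p` has inertia exponent `2` on
its quotient** (mod A40/A41): the Tate line of the multiplicative `p*`-twist model transported
(`exists_isRamifiedOrdinaryLine_shape_of_mult_twist`), whose quotient SHAPE is `D ⊗ χ_{p*}` with `D`
unramified (GV pp. 14–15), hence exponent `2` (`sq_smul_sub_mem_of_quotientShape`).
[cite: GreenbergVatsal2000, §2 pp. 14–15] [cite: EmertonPollackWeston2006, §3.1 (eq:ordes) (arXiv:math/0404484 p. 17)]
[cite: SilvermanATAEC1994, Ch. V Thm. 5.3, Cor. 5.4] -/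
theorem PotMult.exists_isRamifiedOrdinaryLine_and_sq
    (hT40 : Silverman1994_thmV53_tateUniformisation.{0})
    (hT41 : Silverman1994_thmV53_corV54_tateUniformisation.{0}) (hpm : PotMult W p) (hp2 : p ≠ 2)
    (hv : ((p : ℕ) : 𝓞 ℚ) ∈ v.asIdeal) :
    ∃ L : LocalDatum ℚ (W.geomPrimaryTorsion p) v, IsRamifiedOrdinaryLine W p L ∧
      ∀ σ ∈ absInertia (v.adicCompletion ℚ), ∀ m : ↥(W.geomPrimaryTorsion p),
        (absGaloisRestrict ℚ (v.adicCompletion ℚ) σ) ^ 2 • m - m ∈ L.plus := by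
  obtain ⟨V, _, _, C, hV, hC⟩ := hpm.exists_mult_pStar_twist_model hp2
  obtain ⟨K, _, _, hK2, θ, hθ, hθ2⟩ := exists_numberField_sq_eq_pStar hp2
  obtain ⟨L, hL, hshape, -⟩ := exists_isRamifiedOrdinaryLine_shape_of_mult_twist V K hK2 hθ hθ2 p hC
    hT40 hT41 hp2 hV hv (valuation_pStar p v hv)
  refine ⟨L, hL, sq_smul_sub_mem_of_quotientShape L fun σ hσ ↦ ?_⟩
  by_cases hg : absGaloisRestrict ℚ (v.adicCompletion ℚ) σ ∈ galRange (K := ℚ) K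
  · exact Or.inl ((hshape σ hσ).1 hg)
  · exact Or.inr ((hshape σ hσ).2 hg)

/-! ### §4 EVERY ramified ordinary line on a defect-2 row has exponent `2` (uniqueness) -/

/-- **pot-mult(p), odd `p`: EVERY ramified ordinary line of `E` at `v ∋ p` has inertia exponent `2` on
its quotient** (mod A40/A41) — by cc-typer-2's model-free uniqueness
`IsRamifiedOrdinaryLine.eq_of_isRamifiedOrdinaryLine` the given line IS the transported Tate line. This
is the `n = 2` input of cc-typer-2's model-free matching on the (M) member of a link.
[cite: GreenbergVatsal2000, §2 pp. 14–15 and p. 26] [cite: EmertonPollackWeston2006, §3.1 (eq:ordes) (arXiv:math/0404484 p. 17)] -/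
theorem PotMult.sq_smul_sub_mem_of_isRamifiedOrdinaryLine
    (hT40 : Silverman1994_thmV53_tateUniformisation.{0})
    (hT41 : Silverman1994_thmV53_corV54_tateUniformisation.{0}) (hpm : PotMult W p) (hp2 : p ≠ 2)
    (hv : ((p : ℕ) : 𝓞 ℚ) ∈ v.asIdeal) {L : LocalDatum ℚ (W.geomPrimaryTorsion p) v}
    (hL : IsRamifiedOrdinaryLine W p L) :
    ∀ σ ∈ absInertia (v.adicCompletion ℚ), ∀ m : ↥(W.geomPrimaryTorsion p),
      (absGaloisRestrict ℚ (v.adicCompletion ℚ) σ) ^ 2 • m - m ∈ L.plus := by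
  obtain ⟨L', hL', hsq⟩ := hpm.exists_isRamifiedOrdinaryLine_and_sq hT40 hT41 hp2 hv
  rw [hL.eq_of_isRamifiedOrdinaryLine hL' hv]
  exact hsq

/-- **X4(M), every odd `p`: every ramified ordinary line has inertia exponent `2`** (mod A40/A41).
X4(M) stays CONSTRUCTION-SHAPED; nothing booked. [cite: GreenbergVatsal2000, §2 pp. 14–15 and p. 26] -/
theorem ClassX4M.sq_smul_sub_mem_of_isRamifiedOrdinaryLine
    (hT40 : Silverman1994_thmV53_tateUniformisation.{0})
    (hT41 : Silverman1994_thmV53_corV54_tateUniformisation.{0}) (hX : ClassX4M W p)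
    (hv : ((p : ℕ) : 𝓞 ℚ) ∈ v.asIdeal) {L : LocalDatum ℚ (W.geomPrimaryTorsion p) v}
    (hL : IsRamifiedOrdinaryLine W p L) :
    ∀ σ ∈ absInertia (v.adicCompletion ℚ), ∀ m : ↥(W.geomPrimaryTorsion p),
      (absGaloisRestrict ℚ (v.adicCompletion ℚ) σ) ^ 2 • m - m ∈ L.plus :=
  (ClassX4M.potMult W p hX).sq_smul_sub_mem_of_isRamifiedOrdinaryLine hT40 hT41 hX.p_ne_two hv hL

/-- **X3♯(M), odd `p`: every ramified ordinary line has inertia exponent `2`** (mod A40/A41).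
X3♯(M) stays CONSTRUCTION-SHAPED; nothing booked. [cite: GreenbergVatsal2000, §2 pp. 14–15 and p. 26] -/
theorem ClassX3M.sq_smul_sub_mem_of_isRamifiedOrdinaryLine [W.IsGloballyMinimal]
    (hT40 : Silverman1994_thmV53_tateUniformisation.{0})
    (hT41 : Silverman1994_thmV53_corV54_tateUniformisation.{0}) (hX : ClassX3M W p)
    (hv : ((p : ℕ) : 𝓞 ℚ) ∈ v.asIdeal) {L : LocalDatum ℚ (W.geomPrimaryTorsion p) v}
    (hL : IsRamifiedOrdinaryLine W p L) :
    ∀ σ ∈ absInertia (v.adicCompletion ℚ), ∀ m : ↥(W.geomPrimaryTorsion p),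
      (absGaloisRestrict ℚ (v.adicCompletion ℚ) σ) ^ 2 • m - m ∈ L.plus :=
  (ClassX3M.potMult W p hX).sq_smul_sub_mem_of_isRamifiedOrdinaryLine hT40 hT41
    (ClassX3M.p_ne_two W p hX) hv hL

end Summit.BirchSwinnertonDyer.Rank1Residual.AdditivePotMult

namespace Summit.BirchSwinnertonDyer.Rank1Residual.Additive

open RamifiedOrdinaryLineExponentTwo

variable {W : WeierstrassCurve ℚ} [W.IsElliptic] [W.IsGloballyMinimal] {p : ℕ} [hp : Fact p.Prime]
  {v : HeightOneSpectrum (𝓞 ℚ)}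

/-- **(G-ord, `e = 2`), `p` odd: EVERY ramified ordinary line of `E` at `v ∋ p` has inertia exponent
`2` on its quotient** — uniqueness moves §2's exponent to the given line. Class-free binders
`TypeGOrd W p ∧ Addv W p ∧ e_E(p) = 2`; the `n = 2` input of cc-typer-2's model-free matching on a
(G-ord, `e = 2`) member of a link. [cite: GreenbergLNM1716, §2 pp. 62–63 and p. 69]
[cite: GreenbergVatsal2000, §2 p. 26] [cite: EmertonPollackWeston2006, §3.1 (eq:ordes) (arXiv:math/0404484 p. 17)] -/
theorem sq_smul_sub_mem_of_typeGOrd_of_semistabilityIndex_eq_two (hp2 : p ≠ 2) (hG : TypeGOrd W p)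
    (hadd : Addv W p) (he : semistabilityIndex W p = 2) (hpv : ((p : ℕ) : 𝓞 ℚ) ∈ v.asIdeal)
    {L : LocalDatum ℚ ↥(W.geomPrimaryTorsion p) v} (hL : IsRamifiedOrdinaryLine W p L) :
    ∀ σ ∈ absInertia (v.adicCompletion ℚ), ∀ m : ↥(W.geomPrimaryTorsion p),
      (absGaloisRestrict ℚ (v.adicCompletion ℚ) σ) ^ 2 • m - m ∈ L.plus := by
  obtain ⟨L', hL', hsq⟩ := exists_isRamifiedOrdinaryLine_and_sq_of_typeGOrd hp2 hG hadd he hpv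
  rw [hL.eq_of_isRamifiedOrdinaryLine hL' hpv]
  exact hsq

/-- **X4♯(G-ord) ∩ `I₀*`: every ramified ordinary line has inertia exponent `2`.** X4♯(G-ord) stays
CONSTRUCTION-SHAPED; nothing booked. [cite: GreenbergLNM1716, §2 pp. 62–63 and p. 69] [cite: GreenbergVatsal2000, §2 p. 26] -/
theorem ClassX4Gord.sq_smul_sub_mem_of_isRamifiedOrdinaryLine (hX : ClassX4Gord W p)
    (he : semistabilityIndex W p = 2) (hpv : ((p : ℕ) : 𝓞 ℚ) ∈ v.asIdeal)
    {L : LocalDatum ℚ ↥(W.geomPrimaryTorsion p) v} (hL : IsRamifiedOrdinaryLine W p L) :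
    ∀ σ ∈ absInertia (v.adicCompletion ℚ), ∀ m : ↥(W.geomPrimaryTorsion p),
      (absGaloisRestrict ℚ (v.adicCompletion ℚ) σ) ^ 2 • m - m ∈ L.plus :=
  sq_smul_sub_mem_of_typeGOrd_of_semistabilityIndex_eq_two hX.addv.1 hX.typeGOrd hX.addv.2 he hpv hL

/-- **X3♯(G-ord) ∩ `I₀*`, `p` odd: every ramified ordinary line has inertia exponent `2`.** X3♯(G-ord)
stays CONSTRUCTION-SHAPED; nothing booked. [cite: GreenbergLNM1716, §2 pp. 62–63 and p. 69] [cite: GreenbergVatsal2000, §2 p. 26] -/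
theorem ClassX3Gord.sq_smul_sub_mem_of_isRamifiedOrdinaryLine (hp2 : p ≠ 2) (hX : ClassX3Gord W p)
    (he : semistabilityIndex W p = 2) (hpv : ((p : ℕ) : 𝓞 ℚ) ∈ v.asIdeal)
    {L : LocalDatum ℚ ↥(W.geomPrimaryTorsion p) v} (hL : IsRamifiedOrdinaryLine W p L) :
    ∀ σ ∈ absInertia (v.adicCompletion ℚ), ∀ m : ↥(W.geomPrimaryTorsion p),
      (absGaloisRestrict ℚ (v.adicCompletion ℚ) σ) ^ 2 • m - m ∈ L.plus :=
  sq_smul_sub_mem_of_typeGOrd_of_semistabilityIndex_eq_two hp2 hX.typeGOrd hX.addv he hpv hL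

end Summit.BirchSwinnertonDyer.Rank1Residual.Additive

end
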